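import Summits.QuantumFields.BalabanUV.Beta.EriceRemainderEnclosureHistoryAutonomyComparisonMarkovGradingLinks

/-!
# EriceRemainderEnclosureHistoryAutonomyComparisonMarkovGrading — (E139d) **COMPARISON WITH MARKOV GRADING AND MARKOV CREDIT — the a-priori ORBIT-GRADED form of the
# comparison column: the history profile `Λ_k(A)` is read on the box graded by the LEVEL LADDER `ψ^[k+1](A)` of a Markov minorant `G ≤ B` (`level_ge_ladder`), the
# Markov lower slope `μ` gives the credit, and the ROW CONDITION `Σ_{k<K} Λ_k(A)·Σ_{j<k}(1+μ(A+Kβ̄))^{−(j+1)} ≤ 1` at every level `A ≥ 1∕p²` (plus a deep moment `< 1`)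
# yields `h′ ≤ h` for every bounded isotone excess (`le_of_isotone_excess_markov_grading`; `μ ≡ 0`: `le_of_isotone_excess_ladder_moment`).**  (E139b) is the
# ladder `ψ(a) = a + b` of the floor; (E138b) is moreover the constant profile.

WHY (g106 `README.md` §4 (α‴-1) «orbit-graded contraction — needs an a-priori level growth for all box solutions of `B` AND for `h′`»): the growth is the LADDER of the
Markov minorant — `x = a + G(x) ⟹ ψ(a) ≤ x`, so every box solution of every `B″ ≥ G(1∕u_0²)` (in particular of `B` and of `B′ ≥ B`) has its scale-`j` level above
`ψ^[j]` of its pin level ((E139c) `level_ge_ladder`).  A memory that is large in the CURRENT coupling is fast, and its history slopes are read where they have decayed: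
numerically (g107 `kit/markovcheck107.py`) `β₀ + L₀∕a_0 + 10⁵·a_J^{−6}` has top-row effective age moment `3.4 ∕ 0.10 ∕ 0.00` for `L₀ = 0 ∕ 30 ∕ 300` — the grading, not the
credit, is the mechanism, and with `G(x) = b + L₀∕x`, `ψ(a) = (a + b + √((a+b)² + 4L₀))∕2 ≈ √L₀` the row condition certifies it a priori.  For memories WITHOUT a Markov
part the ladder is the floor's and nothing beyond (E139b) is claimed; there the blanket (α‴) is false (g107 `kit/scan107.py`: `L·a_J^{−r}`, `L·e^{−κa_J}` fail at large `L`).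

THE PROOF is (E139b)'s verbatim with the gradings `A + (k+1)b` replaced by `ψ^[k+1](A)`: deep rows by (E139c) `deep_steps_nonneg_gr` ((E138a)'s sequence contraction
fed by the ladder-graded links), then the backward ROW INDUCTION `row_step_nonneg_gr` (damped window gaps (E139a) `gap_le_sum_damped`, credit (E139a) `credit_step_le`,
source monotonicity (E138b) `flow_source_le`), and (E132) `cmp_of_dual_steps_nonneg`.

Cell `pub-balaban`, β-function sub-cell, BINDER row D4 «RemainderConst leaves for Bałaban's split» (`HOME/BINDER-OWNERS.md`; owner lineage `b2b-balaban-beta-an4`;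
this file by co-owner #2 lineage `b2b-balaban-beta-d4-p2`, generation 107), β-FLOW TEAM duty (1), FREEZE (0) honoured (def-free; (E139c) `level_ge_ladder` ∕
`deep_steps_nonneg_gr`, (E139a) `level_le_pin_add` ∕ `gap_le_sum_damped` ∕ `credit_step_le` ∕ `exists_deep_row`, (E138b) `flow_source_le`, (E138a) `dual_step_eq_levels`,
(E132) `cmp_of_dual_steps_nonneg`, (E48a) `le_pin_of_memFlow` ∕ `memFlow_tail`, (E39) `exists_memFlow_zm`, (E43b) `memFlow_unique_of_monotone_zm` BY NAME; the row step
repeats (E139b)'s with the ladder grading, nothing else restated).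

HONEST FRAMING (page 1, verbatim and binding).  *"Discharging BetaPertH makes Bałaban's UV stability UNCONDITIONAL — a real constructive-QFT result; it is
NOT the continuum limit and NOT the Clay problem."*  THIS FILE DISCHARGES NOTHING OF THE KIND.  Elementary real analysis about ABSTRACT functionals on a box
]0,γ]^ℕ (node U2's `MemFlow` ∕ `SeqBox`) — hypotheses of a census, not facts: whether Bałaban's (1.22) limit functional has such profiles, minorants or slopes is NOT
PRINTED ([I] p. 298; GAPS G-t4-U2-1∕-2) and NOT asserted.  Row D4 class UNCHANGED (critical-path width 0; instance 0∕1; D4 DISCHARGE NO DATE).  NOT B12 Thm 2, NOT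
BetaPertH, NOT continuum YM, NOT Clay.

WHAT IS PROVED ([folklore]; 0 `def`, 0 sorry).  §1 **`row_step_nonneg_gr`**.  §2 **`steps_nonneg_gr`**.  §3 **`le_of_isotone_excess_markov_grading`**.
§4 **`le_of_isotone_excess_ladder_moment`**.
-/

noncomputable section
open Finset Set

namespace Summit.QuantumFields.BalabanUV.Beta.EriceRemainderEnclosureHistoryAutonomyComparisonMarkovGrading

open Literature.MathematicalPhysics.QuantumFieldTheory.Balaban1983to89
open Literature.MathematicalPhysics.QuantumFieldTheory.Balaban1983to89.T4BetaStationary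
open Literature.MathematicalPhysics.QuantumFieldTheory.Balaban1983to89.T4BetaFlowWellPosed
open Summit.QuantumFields.BalabanUV.Beta.EriceRemainderEnclosureHistoryAutonomyOrder
  (family_zero family_mem le_pin_of_memFlow memFlow_tail)
open Summit.QuantumFields.BalabanUV.Beta.EriceRemainderEnclosureHistoryAutonomyComparisonDualOrbit (cmp_of_dual_steps_nonneg)
open Summit.QuantumFields.BalabanUV.Beta.EriceRemainderEnclosureHistoryAutonomyComparisonDualContractionLinks (level_ge_pin_add dual_step_eq_levels)
open Summit.QuantumFields.BalabanUV.Beta.EriceRemainderEnclosureHistoryAutonomyComparisonDualContraction (flow_source_le)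
open Summit.QuantumFields.BalabanUV.Beta.EriceRemainderEnclosureHistoryAutonomyComparisonMarkovCreditLinks
  (level_le_pin_add gap_le_sum_damped credit_step_le exists_deep_row)
open Summit.QuantumFields.BalabanUV.Beta.EriceRemainderEnclosureHistoryAutonomyComparisonMarkovGradingLinks
  (iterate_mono level_ge_ladder deep_steps_nonneg_gr)

variable {B B' : (ℕ → ℝ) → ℝ} {M γ b βb : ℝ} {S : ℝ → ℕ → ℝ} {h h' : ℕ → ℝ} {μ G ψ : ℝ → ℝ} {Λ : ℕ → ℝ → ℝ} {K : ℕ}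

/-! ## §1 The row step -/

/-- **THE ROW STEP OF THE BACKWARD INDUCTION.**  Base package (isotone, floor `b > 0`, modulus, unique box solutions `S q`), level-graded profile `Λ_k(A)`, Markov lower
slope `μ` (antitone, `≥ 0`); `B ≤ B′ ≤ β̄` on the box with isotone excess; `h′` a box solution of `B′`.  At a row `m` with level `A = 1∕h′_m²` where the ROW CONDITION
`Σ_{k<K} Λ_k(A)·Σ_{j<k} d^{j+1} ≤ 1`, `d = (1+μ(A + K·β̄))⁻¹`, holds: if the dual steps are non-negative at every row below `m`, then `X_m ≥ 0`.  (Docstring of the file,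
step (2).) [folklore] -/
theorem row_step_nonneg_gr (hb : 0 < b) (hμ0 : ∀ A, 0 ≤ μ A) (hμanti : Antitone μ)
    (hmono : ∀ u v : ℕ → ℝ, SeqBox γ u → SeqBox γ v → (∀ i, u i ≤ v i) → B u ≤ B v)
    (hB : ∀ u u' : ℕ → ℝ, SeqBox γ u → SeqBox γ u' → ∀ D : ℝ, (∀ j, |u j - u' j| ≤ D) → |B u - B u'| ≤ M * D) (hM : 0 ≤ M)
    (hlo : ∀ u, SeqBox γ u → b ≤ B u)
    (hMk : ∀ u v : ℕ → ℝ, SeqBox γ u → SeqBox γ v → (∀ i, u (i + 1) = v (i + 1)) → v 0 ≤ u 0 →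
      B v + μ (1 / v 0 ^ 2) * (1 / v 0 ^ 2 - 1 / u 0 ^ 2) ≤ B u)
    (hS : ∀ p, 0 < p → p ≤ γ → SeqBox γ (S p) ∧ MemFlow B p (S p))
    (huniq : ∀ p, 0 < p → p ≤ γ → ∀ u u' : ℕ → ℝ, SeqBox γ u → SeqBox γ u' → MemFlow B p u → MemFlow B p u' → u = u')
    (hΛ : ∀ k A, 0 ≤ Λ k A)
    (hG : ∀ u, SeqBox γ u → G (1 / u 0 ^ 2) ≤ B u) (hψ : ∀ a x : ℝ, a + G x ≤ x → ψ a ≤ x) (hψmono : Monotone ψ)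
    (hLip : ∀ A : ℝ, ∀ u v : ℕ → ℝ, SeqBox γ u → SeqBox γ v → (∀ k : ℕ, ψ^[k + 1] A ≤ 1 / u k ^ 2) →
      (∀ k : ℕ, ψ^[k + 1] A ≤ 1 / v k ^ 2) → B u - B v ≤ ∑ k ∈ range K, Λ k A * max (1 / v k ^ 2 - 1 / u k ^ 2) 0)
    (hexc : ∀ u, SeqBox γ u → B u ≤ B' u) (hbdd : ∀ u, SeqBox γ u → B' u ≤ βb)
    (hDmono : ∀ u v : ℕ → ℝ, SeqBox γ u → SeqBox γ v → (∀ i, u i ≤ v i) → B' u - B u ≤ B' v - B v)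
    (hh' : SeqBox γ h') {y : ℝ} (hf' : MemFlow B' y h') (m : ℕ)
    (hrow : ∑ k ∈ range K, Λ k (1 / h' m ^ 2) * ∑ j ∈ range k, ((1 + μ (1 / h' m ^ 2 + (K : ℝ) * βb))⁻¹) ^ (j + 1) ≤ 1)
    (hbelow : ∀ n, m < n → 0 ≤ 1 / h' (n + 1) ^ 2 - 1 / S (h' n) 1 ^ 2) :
    0 ≤ 1 / h' (m + 1) ^ 2 - 1 / S (h' m) 1 ^ 2 := by
  by_contra hneg0
  have hneg : 1 / h' (m + 1) ^ 2 - 1 / S (h' m) 1 ^ 2 < 0 := lt_of_not_ge hneg0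
  -- names
  set A : ℝ := 1 / h' m ^ 2 with hA
  set d : ℝ := (1 + μ (A + (K : ℝ) * βb))⁻¹ with hd
  have hlo' : ∀ u, SeqBox γ u → b ≤ B' u := fun u hu => (hlo u hu).trans (hexc u hu)
  have hbddB : ∀ u, SeqBox γ u → B u ≤ βb := fun u hu => (hexc u hu).trans (hbdd u hu)
  have hβb : 0 ≤ βb := by linarith [hlo' h' hh', hbdd h' hh']
  have hd0 : 0 ≤ d := inv_nonneg.mpr (by linarith [hμ0 (A + (K : ℝ) * βb)])
  have hd1 : 0 < 1 + μ (A + (K : ℝ) * βb) := by linarith [hμ0 (A + (K : ℝ) * βb)]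
  have hgrow : ∀ n, 1 / h' (n + 1) ^ 2 ≤ 1 / h' n ^ 2 + βb := fun n => by
    rw [hf'.2 n]; linarith [hbdd _ (seqBox_shift hh' (n + 1))]
  have hpm := hh' m
  have hSm := hS (h' m) hpm.1 hpm.2
  -- the tail orbit from the pin h′_m
  have htailbox : SeqBox γ (fun i => h' (m + i)) := fun i => hh' (m + i)
  have htailflow : MemFlow B' (h' m) (fun i => h' (m + i)) := memFlow_tail hf' m
  -- the perturbed coupling exceeds the base's at scale 1
  have hq1 : 0 < h' (m + 1) := (hh' (m + 1)).1
  have hqS : 0 < S (h' m) 1 := (hSm.1 1).1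
  have hlt : S (h' m) 1 < h' (m + 1) := by
    by_contra hge0
    have hge : h' (m + 1) ≤ S (h' m) 1 := le_of_not_gt hge0
    have : 1 / h' (m + 1) ^ 2 ≥ 1 / S (h' m) 1 ^ 2 :=
      one_div_le_one_div_of_le (pow_pos hq1 2) (pow_le_pow_left₀ hq1.le hge 2)
    linarith
  -- the three configurations
  set u : ℕ → ℝ := fun i => S (h' m) (1 + i) with hu
  set v : ℕ → ℝ := fun i => h' (m + 1 + i) with hv
  set w : ℕ → ℝ := fun i => if i = 0 then h' (m + 1) else S (h' m) (1 + i) with hw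
  have hubox : SeqBox γ u := fun i => hSm.1 (1 + i)
  have hvbox : SeqBox γ v := fun i => hh' (m + 1 + i)
  have hwbox : SeqBox γ w := by
    intro i
    by_cases hi : i = 0
    · simp only [hw, hi, if_true]; exact hh' (m + 1)
    · simp only [hw, hi, if_false]; exact hSm.1 (1 + i)
  -- E_m − X_m = B u − B v ≤ B w − B v
  have hBuw : B u ≤ B w := by
    refine hmono _ _ hubox hwbox fun i => ?_
    by_cases hi : i = 0
    · subst hi; simp only [hu, hw, if_true, add_zero]; exact hlt.le
    · simp [hu, hw, hi]
  -- the graded box above A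
  have hG' : ∀ u, SeqBox γ u → G (1 / u 0 ^ 2) ≤ B' u := fun u hu => (hG u hu).trans (hexc u hu)
  have hgw : ∀ k : ℕ, ψ^[k + 1] A ≤ 1 / w k ^ 2 := by
    intro k
    by_cases hk : k = 0
    · subst hk
      simp only [hw, if_true]
      have := level_ge_ladder hG' hψ hψmono htailbox htailflow (0 + 1)
      rw [hA]; simpa using this
    · simp only [hw, hk, if_false]
      have := level_ge_ladder hG hψ hψmono hSm.1 hSm.2 (1 + k)
      rw [hA, show k + 1 = 1 + k by omega]; simpa using this
  have hgv : ∀ k : ℕ, ψ^[k + 1] A ≤ 1 / v k ^ 2 := by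
    intro k
    have := level_ge_ladder hG' hψ hψmono htailbox htailflow (k + 1)
    simp only [hv]
    rw [hA, show m + 1 + k = m + (k + 1) by omega]; simpa using this
  have hprof := hLip A w v hwbox hvbox hgw hgv
  -- each window gap is at most the damped sum; the l = 0 term vanishes
  have hXm0 : max (1 / h' (m + 0 + 1) ^ 2 - 1 / S (h' (m + 0)) 1 ^ 2) 0 = 0 := by
    rw [add_zero]; exact max_eq_right hneg.le
  -- the credit below: X_{m+l+1} ≤ d · E_m for l + 2 ≤ K
  have hcredit : ∀ l : ℕ, l + 2 ≤ K →
      max (1 / h' (m + (l + 1) + 1) ^ 2 - 1 / S (h' (m + (l + 1))) 1 ^ 2) 0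
        ≤ d * (B' (fun i => h' (m + 1 + i)) - B (fun i => h' (m + 1 + i))) := by
    intro l hl
    have hXn : 0 ≤ 1 / h' (m + (l + 1) + 1) ^ 2 - 1 / S (h' (m + (l + 1))) 1 ^ 2 := hbelow _ (by omega)
    rw [max_eq_left hXn]
    have hc := credit_step_le (B' := B') (μ := μ) hb hmono hB hM hlo hMk hS huniq hh' hf' (m + (l + 1))
      (fun i => by
        have := hbelow (m + (l + 1) + i) (by omega)
        simpa [Nat.add_assoc] using this)
    -- μ at the level 1∕h′_{m+l+2}² is at least μ(A + Kβ̄)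
    have hlev : 1 / h' (m + (l + 1) + 1) ^ 2 ≤ A + (K : ℝ) * βb := by
      have h1 := level_le_pin_add hbdd htailbox htailflow (l + 2)
      push_cast at h1
      rw [show m + (l + 1) + 1 = m + (l + 2) by omega, hA]
      have : ((l : ℝ) + 2) * βb ≤ (K : ℝ) * βb := mul_le_mul_of_nonneg_right (by exact_mod_cast hl) hβb
      linarith
    have hμle : μ (A + (K : ℝ) * βb) ≤ μ (1 / h' (m + (l + 1) + 1) ^ 2) := hμanti hlev
    have hsrc : B' (fun i => h' (m + (l + 1) + 1 + i)) - B (fun i => h' (m + (l + 1) + 1 + i))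
        ≤ B' (fun i => h' (m + 1 + i)) - B (fun i => h' (m + 1 + i)) := flow_source_le hb hlo' hDmono hh' hf' m l
    have hE0 : 0 ≤ B' (fun i => h' (m + (l + 1) + 1 + i)) - B (fun i => h' (m + (l + 1) + 1 + i)) :=
      sub_nonneg.mpr (hexc _ (seqBox_shift hh' _))
    -- (1 + μ(A+Kβ̄))·X ≤ (1 + μ(level))·X ≤ E_{m+l+1} ≤ E_m
    have hkey : (1 + μ (A + (K : ℝ) * βb)) * (1 / h' (m + (l + 1) + 1) ^ 2 - 1 / S (h' (m + (l + 1))) 1 ^ 2)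
        ≤ B' (fun i => h' (m + 1 + i)) - B (fun i => h' (m + 1 + i)) :=
      ((mul_le_mul_of_nonneg_right (by linarith) hXn).trans hc).trans hsrc
    rw [hd, inv_mul_eq_div, le_div_iff₀ hd1, mul_comm]
    exact hkey
  -- bound the damped sums by E_m · Σ_{j<k} d^{j+1}
  have hD : ∀ k ∈ range K, Λ k A * max (1 / v k ^ 2 - 1 / w k ^ 2) 0
      ≤ Λ k A * ((B' (fun i => h' (m + 1 + i)) - B (fun i => h' (m + 1 + i))) * ∑ j ∈ range k, d ^ (j + 1)) := by
    intro k hk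
    have hkK : k < K := mem_range.mp hk
    refine mul_le_mul_of_nonneg_left ?_ (hΛ k A)
    -- the gap is at most the damped sum
    have hgap : max (1 / v k ^ 2 - 1 / w k ^ 2) 0
        ≤ ∑ l ∈ range (k + 1), d ^ (k - l) * max (1 / h' (m + l + 1) ^ 2 - 1 / S (h' (m + l)) 1 ^ 2) 0 := by
      have hsum0 : 0 ≤ ∑ l ∈ range (k + 1), d ^ (k - l) * max (1 / h' (m + l + 1) ^ 2 - 1 / S (h' (m + l)) 1 ^ 2) 0 :=
        sum_nonneg fun l _ => mul_nonneg (pow_nonneg hd0 _) (le_max_right _ _)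
      by_cases hk0 : k = 0
      · subst hk0
        simp only [hv, hw, if_true, add_zero, sub_self, max_self]
        exact hsum0
      · refine max_le ?_ hsum0
        simp only [hv, hw, hk0, if_false]
        have hceil : 1 / h' (m + 1) ^ 2 + (k : ℝ) * βb ≤ A + (K : ℝ) * βb := by
          have h1 := hgrow m
          have : ((k : ℝ) + 1) * βb ≤ (K : ℝ) * βb := mul_le_mul_of_nonneg_right (by exact_mod_cast hkK) hβb
          rw [hA]; linarith
        have := gap_le_sum_damped hb hμ0 hμanti hmono hB hM hlo hbddB hβb hMk hS huniq hh' hgrow k m hceil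
        rw [← hd] at this
        exact this
    refine hgap.trans ?_
    -- split off l = 0 and use the credit on the rest
    rw [sum_range_succ', hXm0, mul_zero, add_zero, mul_sum]
    -- reflect the index on the right: Σ_{j<k} E d^{j+1} = Σ_{l<k} E d^{k-l}
    rw [← sum_range_reflect (fun j => (B' (fun i => h' (m + 1 + i)) - B (fun i => h' (m + 1 + i))) * d ^ (j + 1)) k]
    refine sum_le_sum fun l hl => ?_
    have hlk : l < k := mem_range.mp hl
    rw [show k - 1 - l + 1 = k - l by omega, show k - (l + 1) = k - l - 1 by omega]
    have hdpow : d ^ (k - l) = d ^ (k - l - 1) * d := by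
      rw [← pow_succ, show k - l - 1 + 1 = k - l by omega]
    rw [hdpow]
    have hc := hcredit l (by omega)
    have := mul_le_mul_of_nonneg_left hc (pow_nonneg hd0 (k - l - 1))
    linarith
  -- assemble: E_m − X_m ≤ E_m · ROW ≤ E_m
  have heq := dual_step_eq_levels hS hh' hf' m
  have hE0 : 0 ≤ B' (fun i => h' (m + 1 + i)) - B (fun i => h' (m + 1 + i)) := sub_nonneg.mpr (hexc _ hvbox)
  have htot : B w - B v ≤ (B' (fun i => h' (m + 1 + i)) - B (fun i => h' (m + 1 + i)))
      * ∑ k ∈ range K, Λ k A * ∑ j ∈ range k, d ^ (j + 1) := by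
    refine hprof.trans ((sum_le_sum hD).trans_eq ?_)
    rw [mul_sum]
    exact sum_congr rfl fun k _ => by ring
  have hrow' : ∑ k ∈ range K, Λ k A * ∑ j ∈ range k, d ^ (j + 1) ≤ 1 := by rw [hA, hd]; exact hrow
  have hfin : B w - B v ≤ B' (fun i => h' (m + 1 + i)) - B (fun i => h' (m + 1 + i)) := by
    have := mul_le_mul_of_nonneg_left hrow' hE0
    linarith
  -- E_m − X_m = B u − B v
  have hBv : B (fun i => h' (m + 1 + i)) = B v := rfl
  have hBu : B (fun i => S (h' m) (1 + i)) = B u := rfl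
  linarith [hBuw, hfin, heq]


/-! ## §2 All dual steps are non-negative -/

/-- **ALL DUAL STEPS ARE NON-NEGATIVE** under the row condition at every level `A ≥ 1∕y²` (`y` the pin of `h′`) and a deep age moment below one: the deep rows by
(E139a) `deep_steps_nonneg`, the rows above by the backward induction `row_step_nonneg`. [folklore] -/
theorem steps_nonneg_gr (hb : 0 < b) (hμ0 : ∀ A, 0 ≤ μ A) (hμanti : Antitone μ)
    (hmono : ∀ u v : ℕ → ℝ, SeqBox γ u → SeqBox γ v → (∀ i, u i ≤ v i) → B u ≤ B v)
    (hB : ∀ u u' : ℕ → ℝ, SeqBox γ u → SeqBox γ u' → ∀ D : ℝ, (∀ j, |u j - u' j| ≤ D) → |B u - B u'| ≤ M * D) (hM : 0 ≤ M)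
    (hlo : ∀ u, SeqBox γ u → b ≤ B u)
    (hMk : ∀ u v : ℕ → ℝ, SeqBox γ u → SeqBox γ v → (∀ i, u (i + 1) = v (i + 1)) → v 0 ≤ u 0 →
      B v + μ (1 / v 0 ^ 2) * (1 / v 0 ^ 2 - 1 / u 0 ^ 2) ≤ B u)
    (hS : ∀ p, 0 < p → p ≤ γ → SeqBox γ (S p) ∧ MemFlow B p (S p))
    (huniq : ∀ p, 0 < p → p ≤ γ → ∀ u u' : ℕ → ℝ, SeqBox γ u → SeqBox γ u' → MemFlow B p u → MemFlow B p u' → u = u')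
    (hΛ : ∀ k A, 0 ≤ Λ k A)
    (hG : ∀ u, SeqBox γ u → G (1 / u 0 ^ 2) ≤ B u) (hψ : ∀ a x : ℝ, a + G x ≤ x → ψ a ≤ x) (hψmono : Monotone ψ)
    (hLip : ∀ A : ℝ, ∀ u v : ℕ → ℝ, SeqBox γ u → SeqBox γ v → (∀ k : ℕ, ψ^[k + 1] A ≤ 1 / u k ^ 2) →
      (∀ k : ℕ, ψ^[k + 1] A ≤ 1 / v k ^ 2) → B u - B v ≤ ∑ k ∈ range K, Λ k A * max (1 / v k ^ 2 - 1 / u k ^ 2) 0)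
    (hdeep : ∃ A₀ : ℝ, ∀ A, A₀ ≤ A → ∑ k ∈ range K, (k : ℝ) * Λ k A < 1)
    (hexc : ∀ u, SeqBox γ u → B u ≤ B' u) (hbdd : ∀ u, SeqBox γ u → B' u ≤ βb)
    (hDmono : ∀ u v : ℕ → ℝ, SeqBox γ u → SeqBox γ v → (∀ i, u i ≤ v i) → B' u - B u ≤ B' v - B v)
    (hh' : SeqBox γ h') {y : ℝ} (hf' : MemFlow B' y h')
    (hrow : ∀ A : ℝ, 1 / y ^ 2 ≤ A →
      ∑ k ∈ range K, Λ k A * ∑ j ∈ range k, ((1 + μ (A + (K : ℝ) * βb))⁻¹) ^ (j + 1) ≤ 1) :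
    ∀ n, 0 ≤ 1 / h' (n + 1) ^ 2 - 1 / S (h' n) 1 ^ 2 := by
  obtain ⟨A₀, hA₀⟩ := hdeep
  have hlo' : ∀ u, SeqBox γ u → b ≤ B' u := fun u hu => (hlo u hu).trans (hexc u hu)
  obtain ⟨N, hN⟩ := exists_deep_row hb hlo' hh' hf' A₀
  have hdeepN := deep_steps_nonneg_gr hb hmono hB hM hlo hS huniq hG hψ hψmono hΛ hLip hexc hbdd hDmono hh' hf' N (hA₀ _ hN)
  -- backward induction from the deep row N
  have key : ∀ i : ℕ, ∀ n, N - i ≤ n → 0 ≤ 1 / h' (n + 1) ^ 2 - 1 / S (h' n) 1 ^ 2 := by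
    intro i
    induction i with
    | zero => intro n hn; exact hdeepN n (by simpa using hn)
    | succ i ih =>
      intro n hn
      by_cases hni : N - i ≤ n
      · exact ih n hni
      · have hn1 : ∀ n', n < n' → 0 ≤ 1 / h' (n' + 1) ^ 2 - 1 / S (h' n') 1 ^ 2 := fun n' hn' => ih n' (by omega)
        refine row_step_nonneg_gr hb hμ0 hμanti hmono hB hM hlo hMk hS huniq hΛ hG hψ hψmono hLip hexc hbdd hDmono hh' hf' n (hrow _ ?_) hn1
        have hle := le_pin_of_memFlow hb hlo' hh' hf' n
        exact one_div_le_one_div_of_le (pow_pos (hh' n).1 2) (pow_le_pow_left₀ (hh' n).1.le hle 2)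
  intro n
  exact key N n (by omega)

/-! ## §3 The comparison theorem with Markov credit -/

/-- **COMPARISON WITH MARKOV CREDIT.**  `B`: isotone on the box `]0,γ]^ℕ` with a zeroth moment `M` and floor `b > 0`; a LEVEL-GRADED PROFILE `Λ_k(A) ≥ 0` (for every `A`,
`B u − B v ≤ Σ_{k<K} Λ_k(A)·(1∕v_k² − 1∕u_k²)⁺` on the graded box above `A`) with `Σ_k k·Λ_k(A) < 1` for all deep `A`; a MARKOV LOWER SLOPE `μ ≥ 0`, antitone in the level
(`B v + μ(1∕v_0²)·(1∕v_0² − 1∕u_0²) ≤ B u` for box configurations agreeing at the ages `≥ 1`, `v_0 ≤ u_0`).  `B′`: ANY functional with `B ≤ B′ ≤ β̄` on the box and ISOTONE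
excess.  `h, h′`: box solutions of `B, B′` from one pin `p`.  ROW CONDITION at every level `A ≥ 1∕p²`: `Σ_{k<K} Λ_k(A)·Σ_{j<k} d_A^{j+1} ≤ 1`, `d_A = (1+μ(A + K·β̄))⁻¹`.
Then **`h′ ≤ h` at every scale.**  `μ ≡ 0`: the row-wise graded moment condition (§4); `μ > 0`: the history steepness `Λ` is bought by the Markov slope (`Σ_{j<k}d^{j+1} =
(1 − d^k)∕μ`).  SHARP for the hinge over a Markov pedestal (numerics; Lean successor item). [folklore] -/
theorem le_of_isotone_excess_markov_grading {p : ℝ}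
    (hmono : ∀ u v : ℕ → ℝ, SeqBox γ u → SeqBox γ v → (∀ i, u i ≤ v i) → B u ≤ B v)
    (hB : ∀ u u' : ℕ → ℝ, SeqBox γ u → SeqBox γ u' → ∀ D : ℝ, (∀ j, |u j - u' j| ≤ D) → |B u - B u'| ≤ M * D) (hM : 0 ≤ M)
    (hb : 0 < b) (hlo : ∀ u, SeqBox γ u → b ≤ B u)
    (hΛ : ∀ k A, 0 ≤ Λ k A)
    (hG : ∀ u, SeqBox γ u → G (1 / u 0 ^ 2) ≤ B u) (hψ : ∀ a x : ℝ, a + G x ≤ x → ψ a ≤ x) (hψmono : Monotone ψ)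
    (hLip : ∀ A : ℝ, ∀ u v : ℕ → ℝ, SeqBox γ u → SeqBox γ v → (∀ k : ℕ, ψ^[k + 1] A ≤ 1 / u k ^ 2) →
      (∀ k : ℕ, ψ^[k + 1] A ≤ 1 / v k ^ 2) → B u - B v ≤ ∑ k ∈ range K, Λ k A * max (1 / v k ^ 2 - 1 / u k ^ 2) 0)
    (hdeep : ∃ A₀ : ℝ, ∀ A, A₀ ≤ A → ∑ k ∈ range K, (k : ℝ) * Λ k A < 1)
    (hμ0 : ∀ A, 0 ≤ μ A) (hμanti : Antitone μ)
    (hMk : ∀ u v : ℕ → ℝ, SeqBox γ u → SeqBox γ v → (∀ i, u (i + 1) = v (i + 1)) → v 0 ≤ u 0 →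
      B v + μ (1 / v 0 ^ 2) * (1 / v 0 ^ 2 - 1 / u 0 ^ 2) ≤ B u)
    (hexc : ∀ u, SeqBox γ u → B u ≤ B' u) (hbdd : ∀ u, SeqBox γ u → B' u ≤ βb)
    (hDmono : ∀ u v : ℕ → ℝ, SeqBox γ u → SeqBox γ v → (∀ i, u i ≤ v i) → B' u - B u ≤ B' v - B v)
    (hp : 0 < p) (hpγ : p ≤ γ)
    (hrow : ∀ A : ℝ, 1 / p ^ 2 ≤ A →
      ∑ k ∈ range K, Λ k A * ∑ j ∈ range k, ((1 + μ (A + (K : ℝ) * βb))⁻¹) ^ (j + 1) ≤ 1)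
    (hh : SeqBox γ h) (hf : MemFlow B p h) (hh' : SeqBox γ h') (hf' : MemFlow B' p h') (j : ℕ) :
    h' j ≤ h j := by
  -- the unique base family
  have hex : ∀ q : ℝ, 0 < q → q ≤ γ → ∃ k : ℕ → ℝ, SeqBox γ k ∧ MemFlow B q k :=
    fun q hq hqγ => Summit.QuantumFields.BalabanUV.Beta.EriceRemainderEnclosureHistoryAutonomyExistence.exists_memFlow_zm hB hM hq hqγ hb hlo
  choose! S hSb hSf using hex
  have hS : ∀ q, 0 < q → q ≤ γ → SeqBox γ (S q) ∧ MemFlow B q (S q) := fun q hq hqγ => ⟨hSb q hq hqγ, hSf q hq hqγ⟩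
  have huniq : ∀ q, 0 < q → q ≤ γ → ∀ u u' : ℕ → ℝ, SeqBox γ u → SeqBox γ u' → MemFlow B q u → MemFlow B q u' → u = u' :=
    fun q hq _ u u' hu hu' hfu hfu' =>
      Summit.QuantumFields.BalabanUV.Beta.EriceRemainderEnclosureHistoryAutonomyMonotoneGeneral.memFlow_unique_of_monotone_zm hmono hB hM hq hb hlo hu hu' hfu hfu'
  have e : h = S p := huniq p hp hpγ _ _ hh (hS p hp hpγ).1 hf (hS p hp hpγ).2
  rw [e]
  refine cmp_of_dual_steps_nonneg (B' := B') hb hB hM hlo hS huniq hp hpγ hh' hf' j (fun i _ => ?_) j le_rfl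
  have h0 := steps_nonneg_gr hb hμ0 hμanti hmono hB hM hlo hMk hS huniq hΛ hG hψ hψmono hLip hdeep hexc hbdd hDmono hh' hf' hrow i
  have heq := dual_step_eq_levels hS hh' hf' i
  linarith

/-! ## §4 The row-wise graded form of (E138): no Markov slope -/

/-- **COMPARISON FOR EVERY ISOTONE EXCESS UNDER THE ROW-WISE GRADED AGE MOMENT** — the case `μ ≡ 0` of `le_of_isotone_excess_markov_credit`: base package, level-graded
profile `Λ_k(A)` with **`Σ_{k<K} k·Λ_k(A) ≤ 1` at every level `A ≥ 1∕p²`** and `< 1` for all deep `A`; `B ≤ B′ ≤ β̄`, isotone excess.  Then `h′ ≤ h` at every scale.  With a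
constant profile this is (E138b) `le_of_isotone_excess_moment`; the gain is that the profile is read on the graded box ABOVE THE ORBIT'S OWN LEVEL at every row (steep
tops whose slope has decayed where the orbit reads them). [folklore] -/
theorem le_of_isotone_excess_ladder_moment {p : ℝ}
    (hmono : ∀ u v : ℕ → ℝ, SeqBox γ u → SeqBox γ v → (∀ i, u i ≤ v i) → B u ≤ B v)
    (hB : ∀ u u' : ℕ → ℝ, SeqBox γ u → SeqBox γ u' → ∀ D : ℝ, (∀ j, |u j - u' j| ≤ D) → |B u - B u'| ≤ M * D) (hM : 0 ≤ M)
    (hb : 0 < b) (hlo : ∀ u, SeqBox γ u → b ≤ B u)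
    (hΛ : ∀ k A, 0 ≤ Λ k A)
    (hG : ∀ u, SeqBox γ u → G (1 / u 0 ^ 2) ≤ B u) (hψ : ∀ a x : ℝ, a + G x ≤ x → ψ a ≤ x) (hψmono : Monotone ψ)
    (hLip : ∀ A : ℝ, ∀ u v : ℕ → ℝ, SeqBox γ u → SeqBox γ v → (∀ k : ℕ, ψ^[k + 1] A ≤ 1 / u k ^ 2) →
      (∀ k : ℕ, ψ^[k + 1] A ≤ 1 / v k ^ 2) → B u - B v ≤ ∑ k ∈ range K, Λ k A * max (1 / v k ^ 2 - 1 / u k ^ 2) 0)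
    (hdeep : ∃ A₀ : ℝ, ∀ A, A₀ ≤ A → ∑ k ∈ range K, (k : ℝ) * Λ k A < 1)
    (hexc : ∀ u, SeqBox γ u → B u ≤ B' u) (hbdd : ∀ u, SeqBox γ u → B' u ≤ βb)
    (hDmono : ∀ u v : ℕ → ℝ, SeqBox γ u → SeqBox γ v → (∀ i, u i ≤ v i) → B' u - B u ≤ B' v - B v)
    (hp : 0 < p) (hpγ : p ≤ γ)
    (hrow : ∀ A : ℝ, 1 / p ^ 2 ≤ A → ∑ k ∈ range K, (k : ℝ) * Λ k A ≤ 1)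
    (hh : SeqBox γ h) (hf : MemFlow B p h) (hh' : SeqBox γ h') (hf' : MemFlow B' p h') (j : ℕ) :
    h' j ≤ h j := by
  refine le_of_isotone_excess_markov_grading (μ := fun _ => 0) hmono hB hM hb hlo hΛ hG hψ hψmono hLip hdeep (fun _ => le_rfl)
    (fun _ _ _ => le_rfl) ?_ hexc hbdd hDmono hp hpγ ?_ hh hf hh' hf' j
  · intro u v hu hv hagree hle
    have hvu : B v ≤ B u := hmono v u hv hu fun i => by
      cases i with
      | zero => exact hle
      | succ i => exact (hagree i).symm.le
    simpa using hvu
  · intro A hA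
    have e : ∀ k : ℕ, ∑ j ∈ range k, ((1 + (0 : ℝ))⁻¹) ^ (j + 1) = (k : ℝ) := fun k => by simp
    simp only [e]
    calc ∑ k ∈ range K, Λ k A * (k : ℝ) = ∑ k ∈ range K, (k : ℝ) * Λ k A := sum_congr rfl fun k _ => mul_comm _ _
      _ ≤ 1 := hrow A hA

end Summit.QuantumFields.BalabanUV.Beta.EriceRemainderEnclosureHistoryAutonomyComparisonMarkovGrading

end
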